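import Literature.MathematicalPhysics.QuantumLattice.SU2HaarChart
import HarnessLib

/-!
# Exact zero-mode rung on the GROUP, three letters — V-a: Gaussian and coordinate tools
# (rung Z4 in Laplace form; free-hands support of ⟨stmt-QuantumFields-24197⟩, LINE «sharp-sigma»)

Mathlib-level tools for the dominated-convergence step of the exact three-letter zero-mode rung
`β²·∫_{SU(2)³} e^{−β(‖[q₀,q₁]‖²+‖[q₀,q₂]‖²+‖[q₁,q₂]‖²)} dHaar³ → v₃` (parts I–IV: `…ZeroModeGroupThree{Ball,Axis,Scaling,Pointwise}`):
* §1 Gaussian integrals as Lebesgue integrals: `∫ e^{−bx²} = √(π/b)`, the linear-term version, and the COUPLED two-dimensional Gaussian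
  ★ `lintegral_exp_neg_quadForm_two : ∫_{ℝ²} e^{−(αu²+2γuv+δv²)} = π/√(αδ−γ²)` (complete the square, translation invariance, Tonelli) —
  the integral behind the no-log mechanism `∫ e^{−4[r²|w|² + |z∧w|²]} dw = π/(4r√(r²+|z|²))`;
* §1' the even integrable singularity `∫_{(−1,1)} (u²)^{−s} du < ∞` (`0 < s < 1/2`), the weighted AM–GM for three terms, and the product interchange
  `((a,b),(c,d)) ↦ ((a,c),(b,d))` of product measures (★ `measurePreserving_prodInterchange`);
* §2 coordinates: ★ `measurePreserving_coord4 : x ↦ (x₀,(x_I,(x_J,x_K)))` carries Lebesgue measure on `ℍ` to `ℝ × (ℝ × (ℝ × ℝ))`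
  (✓`quatReImEquiv` + `piFinSuccAbove` + `finTwoArrow`), and the PAIR coordinates ★ `measurePreserving_pairCoord :
  (x,y) ↦ ((x₀,y₀),((x_I,y_I),((x_J,y_J),(x_K,y_K))))` (three interchanges) — the frame in which the dominator of part IV factorises.
HONEST LABEL: elementary real analysis / measure plumbing (plan-level zero-mode rung); NOT the fixed-`L` sharp law, NOT ⟨24197⟩; the Yang–Mills
mass gap is NOT proved; no summit is proved by a line.  Width seat ym-line-sfw-p2-w2 g55 (cell ym-idea-1, free hands; own crux ⟨22884⟩
blocked-on ⟨19935⟩), `--supports stmt-QuantumFields-24197`.  Standard axioms, 0 `sorry`; the two quaternion local instances of ✓`SU2HaarChart`.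
References: [cite: GonzalezarroyoAltes1988]; [cite: Vanbaal2001]; [folklore].
-/

set_option autoImplicit false

noncomputable section

open MeasureTheory Quaternion Set Filter Topology
open scoped Quaternion ENNReal
open Literature.MathematicalPhysics.QuantumLattice

attribute [local instance] Literature.Analysis.FluidPDE.Tao2016.quatMeasurableSpace
  Literature.Analysis.FluidPDE.Tao2016.quatBorelSpace

namespace Summit.QuantumFields.YangMills.Theorems.SwapVirialDeficit.ZeroModeGroup

/-! ## §1 Gaussian integrals, an integrable singularity, AM–GM, product interchange -/
/-- The Gaussian integral as a Lebesgue integral: `∫ e^{−bx²} dx = √(π/b)` (`b > 0`). [folklore] -/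
theorem lintegral_exp_neg_mul_sq {b : ℝ} (hb : 0 < b) :
    ∫⁻ x : ℝ, ENNReal.ofReal (Real.exp (-(b * x ^ 2))) = ENNReal.ofReal (Real.sqrt (Real.pi / b)) := by
  have h := (ofReal_integral_eq_lintegral_ofReal (integrable_exp_neg_mul_sq hb) (ae_of_all _ fun x => (Real.exp_pos _).le)).symm
  rw [integral_gaussian] at h
  simpa only [neg_mul] using h

/-- A Gaussian integral with a linear term: `∫ e^{−(At² − 2Bt + C)} dt = √(π/A)·e^{B²/A − C}` (`A > 0`). [folklore] -/
theorem lintegral_exp_neg_quad {A : ℝ} (hA : 0 < A) (B C : ℝ) :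
    ∫⁻ t : ℝ, ENNReal.ofReal (Real.exp (-(A * t ^ 2 - 2 * B * t + C))) =
      ENNReal.ofReal (Real.sqrt (Real.pi / A) * Real.exp (B ^ 2 / A - C)) := by
  have hpt : ∀ t : ℝ, Real.exp (-(A * t ^ 2 - 2 * B * t + C)) = Real.exp (-(A * (t - B / A) ^ 2)) * Real.exp (B ^ 2 / A - C) := by
    intro t; rw [← Real.exp_add]; congr 1; field_simp; ring
  simp_rw [hpt, ENNReal.ofReal_mul (Real.exp_pos _).le]
  have hm : Measurable fun t : ℝ => ENNReal.ofReal (Real.exp (-(A * (t - B / A) ^ 2))) :=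
    ENNReal.measurable_ofReal.comp (Real.measurable_exp.comp (by fun_prop))
  rw [lintegral_mul_const _ hm]
  have ht := lintegral_sub_right_eq_self (μ := (volume : Measure ℝ)) (fun u : ℝ => ENNReal.ofReal (Real.exp (-(A * u ^ 2)))) (B / A)
  rw [ht, lintegral_exp_neg_mul_sq hA, ← ENNReal.ofReal_mul (Real.sqrt_nonneg _)]

/-- The coupled two-dimensional Gaussian: `∫_{ℝ²} e^{−(αu² + 2γuv + δv²)} du dv = π/√(αδ − γ²)` (`δ > 0`, `αδ > γ²`). [folklore] -/
theorem lintegral_exp_neg_quadForm_two {α γ δ : ℝ} (hδ : 0 < δ) (hD : 0 < α * δ - γ ^ 2) :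
    ∫⁻ p : ℝ × ℝ, ENNReal.ofReal (Real.exp (-(α * p.1 ^ 2 + 2 * γ * p.1 * p.2 + δ * p.2 ^ 2))) =
      ENNReal.ofReal (Real.pi / Real.sqrt (α * δ - γ ^ 2)) := by
  have hmeas : Measurable fun p : ℝ × ℝ => ENNReal.ofReal (Real.exp (-(α * p.1 ^ 2 + 2 * γ * p.1 * p.2 + δ * p.2 ^ 2))) :=
    ENNReal.measurable_ofReal.comp (Real.measurable_exp.comp (by fun_prop))
  rw [Measure.volume_eq_prod, lintegral_prod _ hmeas.aemeasurable]
  have hin : ∀ x : ℝ, ∫⁻ y, ENNReal.ofReal (Real.exp (-(α * x ^ 2 + 2 * γ * x * y + δ * y ^ 2))) =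
      ENNReal.ofReal (Real.sqrt (Real.pi / δ)) * ENNReal.ofReal (Real.exp (-((α * δ - γ ^ 2) / δ * x ^ 2))) := by
    intro x
    have e : ∀ y : ℝ, α * x ^ 2 + 2 * γ * x * y + δ * y ^ 2 = δ * y ^ 2 - 2 * (-(γ * x)) * y + α * x ^ 2 := fun y => by ring
    simp_rw [e, lintegral_exp_neg_quad hδ, ← ENNReal.ofReal_mul (Real.sqrt_nonneg _)]
    congr 2; congr 1; field_simp; ring
  simp_rw [hin]
  have hm1 : Measurable fun x : ℝ => ENNReal.ofReal (Real.exp (-((α * δ - γ ^ 2) / δ * x ^ 2))) :=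
    ENNReal.measurable_ofReal.comp (Real.measurable_exp.comp (by fun_prop))
  rw [lintegral_const_mul _ hm1, lintegral_exp_neg_mul_sq (div_pos hD hδ), ← ENNReal.ofReal_mul (Real.sqrt_nonneg _)]
  congr 1
  rw [← Real.sqrt_mul (div_nonneg Real.pi_pos.le hδ.le),
    show Real.pi / δ * (Real.pi / ((α * δ - γ ^ 2) / δ)) = Real.pi ^ 2 / (α * δ - γ ^ 2) by field_simp,
    Real.sqrt_div (sq_nonneg _), Real.sqrt_sq Real.pi_pos.le]

/-- `∫_{(0,1)} u^s du < ∞` for `s > −1`. [folklore] -/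
theorem lintegral_Ioo_rpow_lt_top {s : ℝ} (hs : -1 < s) :
    ∫⁻ u in Ioo (0:ℝ) 1, ENNReal.ofReal (u ^ s) < ∞ := by
  have hi : IntegrableOn (fun u : ℝ => u ^ s) (Ioo 0 1) := (intervalIntegral.integrableOn_Ioo_rpow_iff one_pos).2 hs
  exact lt_of_le_of_lt (lintegral_ofReal_le_lintegral_enorm _) hi.2

/-- `∫_{(−1,1)} (u²)^{−s} du < ∞` for `0 < s < 1/2` (an even integrable singularity at `0`). [folklore] -/
theorem lintegral_sqBox_rpow_lt_top {s : ℝ} (hs0 : 0 < s) (hs : 2 * s < 1) :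
    ∫⁻ u : ℝ, {u : ℝ | u ^ 2 < 1}.indicator (fun u => ENNReal.ofReal ((u ^ 2) ^ (-s))) u < ∞ := by
  set G : ℝ → ℝ≥0∞ := fun u => (Ioo (0:ℝ) 1).indicator (fun u => ENNReal.ofReal (u ^ (-(2 * s)))) u with hG
  have hGm : Measurable G := by
    refine Measurable.indicator (ENNReal.measurable_ofReal.comp ?_) measurableSet_Ioo
    exact Measurable.pow_const measurable_id _
  have key : ∀ u : ℝ, 0 < u → u ^ 2 < 1 → {u : ℝ | u ^ 2 < 1}.indicator (fun u => ENNReal.ofReal ((u ^ 2) ^ (-s))) u = G u := by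
    intro u hu h1
    have hu1 : u < 1 := by nlinarith
    rw [indicator_of_mem (show u ∈ {u : ℝ | u ^ 2 < 1} from h1), hG]
    simp only [indicator_of_mem (show u ∈ Ioo (0:ℝ) 1 from ⟨hu, hu1⟩)]
    congr 1
    rw [← Real.rpow_natCast u 2, ← Real.rpow_mul hu.le]
    congr 1; push_cast; ring
  have hpt : ∀ u : ℝ, {u : ℝ | u ^ 2 < 1}.indicator (fun u => ENNReal.ofReal ((u ^ 2) ^ (-s))) u ≤ G u + G (-u) := by
    intro u
    by_cases h1 : u ^ 2 < 1
    · rcases lt_trichotomy u 0 with hu | hu | hu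
      · have hev : {u : ℝ | u ^ 2 < 1}.indicator (fun u => ENNReal.ofReal ((u ^ 2) ^ (-s))) u =
            {u : ℝ | u ^ 2 < 1}.indicator (fun u => ENNReal.ofReal ((u ^ 2) ^ (-s))) (-u) := by
          rw [indicator_of_mem (show u ∈ {u : ℝ | u ^ 2 < 1} from h1),
            indicator_of_mem (show -u ∈ {u : ℝ | u ^ 2 < 1} by simpa using h1), neg_sq]
        rw [hev, key (-u) (by linarith) (by simpa using h1)]
        exact le_add_self
      · subst hu
        rw [indicator_of_mem (show (0:ℝ) ∈ {u : ℝ | u ^ 2 < 1} by simp),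
          show ((0:ℝ) ^ 2) ^ (-s) = 0 by rw [zero_pow two_ne_zero]; exact Real.zero_rpow (by linarith)]
        simp
      · rw [key u hu h1]; exact le_self_add
    · rw [indicator_of_notMem (show u ∉ {u : ℝ | u ^ 2 < 1} from h1)]; exact bot_le
  calc ∫⁻ u, {u : ℝ | u ^ 2 < 1}.indicator (fun u => ENNReal.ofReal ((u ^ 2) ^ (-s))) u
      ≤ ∫⁻ u, G u + G (-u) := lintegral_mono hpt
    _ = (∫⁻ u, G u) + ∫⁻ u : ℝ, G (-u) := lintegral_add_left hGm _
    _ = (∫⁻ u, G u) + ∫⁻ u, G u := by rw [lintegral_neg_eq_self]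
    _ < ∞ := by
      have hfin : ∫⁻ u, G u < ∞ := by
        rw [hG, lintegral_indicator measurableSet_Ioo]
        exact lintegral_Ioo_rpow_lt_top (by linarith)
      exact ENNReal.add_lt_top.2 ⟨hfin, hfin⟩

/-- `vol{u : u² < 1} = 2`. [folklore] -/
theorem volume_sqBox_one : (volume : Measure ℝ) {u : ℝ | u ^ 2 < 1} = 2 := by
  rw [show {u : ℝ | u ^ 2 < 1} = Ioo (-1) 1 by
    ext u; simp only [mem_setOf_eq, mem_Ioo]; constructor
    · intro h; constructor <;> nlinarith
    · intro h; nlinarith [h.1, h.2]]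
  rw [Real.volume_Ioo]; norm_num

/-- Weighted AM–GM for three terms, in the form used for the singular weights:
`(t₁+t₂+t₃)^{−p} ≤ 3^{−p}·t₁^{−p/3}t₂^{−p/3}t₃^{−p/3}` (`tᵢ > 0`, `p ≥ 0`). [folklore] -/
theorem rpow_neg_sum_three_le {t₁ t₂ t₃ p : ℝ} (h₁ : 0 < t₁) (h₂ : 0 < t₂) (h₃ : 0 < t₃) (hp : 0 ≤ p) :
    (t₁ + t₂ + t₃) ^ (-p) ≤ (3:ℝ) ^ (-p) * (t₁ ^ (-(p / 3)) * t₂ ^ (-(p / 3)) * t₃ ^ (-(p / 3))) := by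
  have hG := Real.geom_mean_le_arith_mean3_weighted (w₁ := 1/3) (w₂ := 1/3) (w₃ := 1/3) (p₁ := t₁) (p₂ := t₂) (p₃ := t₃)
    (by norm_num) (by norm_num) (by norm_num) h₁.le h₂.le h₃.le (by norm_num)
  have hGpos : 0 < t₁ ^ (1/3:ℝ) * t₂ ^ (1/3:ℝ) * t₃ ^ (1/3:ℝ) := by positivity
  have h3G : 3 * (t₁ ^ (1/3:ℝ) * t₂ ^ (1/3:ℝ) * t₃ ^ (1/3:ℝ)) ≤ t₁ + t₂ + t₃ := by linarith
  have step : (t₁ + t₂ + t₃) ^ (-p) ≤ (3 * (t₁ ^ (1/3:ℝ) * t₂ ^ (1/3:ℝ) * t₃ ^ (1/3:ℝ))) ^ (-p) :=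
    Real.rpow_le_rpow_of_nonpos (by positivity) h3G (by linarith)
  refine step.trans (le_of_eq ?_)
  have e : (1/3 : ℝ) * -p = -(p / 3) := by ring
  rw [Real.mul_rpow (by norm_num) hGpos.le, Real.mul_rpow (by positivity) (by positivity), Real.mul_rpow (by positivity) (by positivity),
    ← Real.rpow_mul h₁.le, ← Real.rpow_mul h₂.le, ← Real.rpow_mul h₃.le, e]

/-- The product interchange `((a,b),(c,d)) ↦ ((a,c),(b,d))` preserves product measures. [folklore] -/
theorem measurePreserving_prodInterchange {α β γ δ : Type*} [MeasurableSpace α] [MeasurableSpace β] [MeasurableSpace γ]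
    [MeasurableSpace δ] (μa : Measure α) (μb : Measure β) (μc : Measure γ) (μd : Measure δ)
    [SFinite μa] [SFinite μb] [SFinite μc] [SFinite μd] :
    MeasurePreserving (fun z : (α × β) × (γ × δ) => ((z.1.1, z.2.1), (z.1.2, z.2.2)))
      ((μa.prod μb).prod (μc.prod μd)) ((μa.prod μc).prod (μb.prod μd)) := by
  have h1 : MeasurePreserving (MeasurableEquiv.prodAssoc : (α × β) × (γ × δ) ≃ᵐ α × (β × (γ × δ)))
      ((μa.prod μb).prod (μc.prod μd)) (μa.prod (μb.prod (μc.prod μd))) := measurePreserving_prodAssoc μa μb (μc.prod μd)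
  have h2 : MeasurePreserving (Prod.map id (MeasurableEquiv.prodAssoc : (β × γ) × δ ≃ᵐ β × (γ × δ)).symm)
      (μa.prod (μb.prod (μc.prod μd))) (μa.prod ((μb.prod μc).prod μd)) :=
    (MeasurePreserving.id μa).prod ((measurePreserving_prodAssoc μb μc μd).symm _)
  have h3 : MeasurePreserving (Prod.map id (Prod.map Prod.swap id) : α × ((β × γ) × δ) → α × ((γ × β) × δ))
      (μa.prod ((μb.prod μc).prod μd)) (μa.prod ((μc.prod μb).prod μd)) :=
    (MeasurePreserving.id μa).prod ((Measure.measurePreserving_swap).prod (MeasurePreserving.id μd))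
  have h4 : MeasurePreserving (Prod.map id (MeasurableEquiv.prodAssoc : (γ × β) × δ ≃ᵐ γ × (β × δ)))
      (μa.prod ((μc.prod μb).prod μd)) (μa.prod (μc.prod (μb.prod μd))) :=
    (MeasurePreserving.id μa).prod (measurePreserving_prodAssoc μc μb μd)
  have h5 : MeasurePreserving (MeasurableEquiv.prodAssoc : (α × γ) × (β × δ) ≃ᵐ α × (γ × (β × δ))).symm
      (μa.prod (μc.prod (μb.prod μd))) ((μa.prod μc).prod (μb.prod μd)) := (measurePreserving_prodAssoc μa μc (μb.prod μd)).symm _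
  have e : (fun z : (α × β) × (γ × δ) => ((z.1.1, z.2.1), (z.1.2, z.2.2))) =
      (MeasurableEquiv.prodAssoc : (α × γ) × (β × δ) ≃ᵐ α × (γ × (β × δ))).symm ∘
        (Prod.map id (MeasurableEquiv.prodAssoc : (γ × β) × δ ≃ᵐ γ × (β × δ))) ∘
        (Prod.map id (Prod.map Prod.swap id) : α × ((β × γ) × δ) → α × ((γ × β) × δ)) ∘
        (Prod.map id (MeasurableEquiv.prodAssoc : (β × γ) × δ ≃ᵐ β × (γ × δ)).symm) ∘
        (MeasurableEquiv.prodAssoc : (α × β) × (γ × δ) ≃ᵐ α × (β × (γ × δ))) := by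
    funext z; rfl
  rw [e]
  exact h5.comp (h4.comp (h3.comp (h2.comp h1)))

/-! ## §2 Coordinates on `ℍ` and on `ℍ × ℍ` -/

/-- Splitting `ℝ³` as `ℝ × (ℝ × ℝ)`: `v ↦ (v 0, (v 1, v 2))`, measurably and measure-preservingly. [folklore] -/
def split3 : (Fin 3 → ℝ) → ℝ × (ℝ × ℝ) :=
  (Prod.map id (MeasurableEquiv.finTwoArrow : (Fin 2 → ℝ) ≃ᵐ ℝ × ℝ)) ∘ (MeasurableEquiv.piFinSuccAbove (fun _ : Fin 3 => ℝ) 0)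

/-- `split3 v = (v 0, (v 1, v 2))`. [folklore] -/
theorem split3_apply (v : Fin 3 → ℝ) : split3 v = (v 0, (v 1, v 2)) := by
  simp [split3]
  exact ⟨rfl, rfl⟩

/-- `split3` preserves Lebesgue measure. [folklore] -/
theorem measurePreserving_split3 : MeasurePreserving split3 volume volume :=
  ((MeasurePreserving.id volume).prod (volume_preserving_finTwoArrow ℝ)).comp (volume_preserving_piFinSuccAbove (fun _ : Fin 3 => ℝ) 0)

/-- Coordinates `x ↦ (x₀, (x_I, (x_J, x_K)))` on `ℍ`. [folklore] -/
def coord4 (x : ℍ) : ℝ × (ℝ × (ℝ × ℝ)) := (x.re, (x.imI, (x.imJ, x.imK)))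

/-- `coord4` as a composite of measurable equivalences. [folklore] -/
theorem coord4_eq : coord4 = (Prod.map id split3) ∘ quatReImEquiv := by
  funext x
  simp only [coord4, Function.comp_apply, quatReImEquiv_apply, Prod.map_apply, id, split3_apply,
    Matrix.cons_val_zero, Matrix.cons_val_one, Matrix.cons_val_two, Matrix.head_cons, Matrix.tail_cons]

/-- `coord4` carries Lebesgue measure on `ℍ` to the product Lebesgue measure. [folklore] -/
theorem measurePreserving_coord4 : MeasurePreserving coord4 volume volume := by
  rw [coord4_eq]
  exact ((MeasurePreserving.id volume).prod measurePreserving_split3).comp measurePreserving_quatReImEquiv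

/-- Change of variables to coordinates. [folklore] -/
theorem lintegral_eq_lintegral_coord4 (f : ℝ × (ℝ × (ℝ × ℝ)) → ℝ≥0∞) (hf : Measurable f) :
    ∫⁻ x : ℍ, f (coord4 x) = ∫⁻ p : ℝ × (ℝ × (ℝ × ℝ)), f p := by
  exact measurePreserving_coord4.lintegral_comp hf

/-- The pair coordinates `(x, y) ↦ ((x₀,y₀), ((x_I,y_I), ((x_J,y_J), (x_K,y_K))))`. [folklore] -/
def pairCoord (z : ℍ × ℍ) : (ℝ × ℝ) × ((ℝ × ℝ) × ((ℝ × ℝ) × (ℝ × ℝ))) :=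
  ((z.1.re, z.2.re), ((z.1.imI, z.2.imI), ((z.1.imJ, z.2.imJ), (z.1.imK, z.2.imK))))

/-- `pairCoord` as `coord4 × coord4` followed by three interchanges. [folklore] -/
theorem pairCoord_eq : pairCoord =
    (Prod.map id (Prod.map id (fun z : (ℝ × ℝ) × (ℝ × ℝ) => ((z.1.1, z.2.1), (z.1.2, z.2.2))))) ∘
    (Prod.map id (fun z : (ℝ × (ℝ × ℝ)) × (ℝ × (ℝ × ℝ)) => ((z.1.1, z.2.1), (z.1.2, z.2.2)))) ∘
    (fun z : (ℝ × (ℝ × (ℝ × ℝ))) × (ℝ × (ℝ × (ℝ × ℝ))) => ((z.1.1, z.2.1), (z.1.2, z.2.2))) ∘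
    (Prod.map coord4 coord4) := by
  funext z; rfl

/-- `pairCoord` carries `vol ⊗ vol` on `ℍ × ℍ` to the product Lebesgue measure. [folklore] -/
theorem measurePreserving_pairCoord : MeasurePreserving pairCoord ((volume : Measure ℍ).prod volume) volume := by
  rw [pairCoord_eq]
  have hD := measurePreserving_coord4.prod measurePreserving_coord4
  have hC := measurePreserving_prodInterchange (volume : Measure ℝ) (volume : Measure (ℝ × (ℝ × ℝ))) (volume : Measure ℝ)
    (volume : Measure (ℝ × (ℝ × ℝ)))
  have hB := (MeasurePreserving.id (volume : Measure (ℝ × ℝ))).prod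
    (measurePreserving_prodInterchange (volume : Measure ℝ) (volume : Measure (ℝ × ℝ)) (volume : Measure ℝ) (volume : Measure (ℝ × ℝ)))
  have hA := (MeasurePreserving.id (volume : Measure (ℝ × ℝ))).prod ((MeasurePreserving.id (volume : Measure (ℝ × ℝ))).prod
    (measurePreserving_prodInterchange (volume : Measure ℝ) (volume : Measure ℝ) (volume : Measure ℝ) (volume : Measure ℝ)))
  exact hA.comp (hB.comp (hC.comp hD))

end Summit.QuantumFields.YangMills.Theorems.SwapVirialDeficit.ZeroModeGroup

end
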